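import Literature.AlgebraicGeometry.Motives.HirschowitzIyerRuledSurface
import Literature.AlgebraicGeometry.Motives.HirschowitzIyerVerticalFlag
import Literature.AlgebraicGeometry.Motives.StrongLineChartForms
import HarnessLib

/-!
# The ruled surface of Hirschowitz–Iyer's Lemma 2.2 (`s = 0`), III: the vertical fibres are strong lines

Hirschowitz–Iyer 2010, proof of Lemma 2.2: "`pr_{2*}(ψ⁻¹(D))` lies in `QCH^{(s+1)}_r(Y)`" — the fibres
of the projective bundle `H'_Z → Z` over closed points `z` are strong `(s+1)`-planes, here strong
LINES of the pair `V₊(Q, C) ⊂ V₊(Q)`. For the tree's ruled surface `S ⊆ ℙ⁸ ×_K Z` (closure of the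
generic strong line, `Motives/HirschowitzIyerRuledSurface`) this is the valuative statement **limits
of strong lines are strong lines**, proved in coordinates:

* the generic strong line is a `3`-fat flag `(u, v, y)` over `K(Z)` (`isFatFlag_Kz`); at a closed
  point `z` the local ring `𝒪 = 𝒪_{Z,z}` is a discrete valuation ring of `K(Z)`, and the Plücker
  pivot (`StrongLineCover.exists_integral_fatFlag_of_linearIndependent`) moves the flag into `𝒪⁹`
  in chart normal form, spanning the same line;
* the chart forms `x_c - u_c x_{i₀} - v_c x_{j₀}` (coefficients in `𝒪`, cleared to sections over an
  affine neighbourhood of `z`) vanish on the generic line, hence — by the specialisation lemma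
  `ProjFamily.map_mem_asHomogeneousIdeal_of_mem_closure` (`Motives/ProjFamilySpecialization`), as
  in `Motives/VerticalLimitsOfLines` — their reductions vanish at `pr₁ s` for every point `s ∈ S`
  over `z`;
* the reduced flag is a fat flag over `K` in chart normal form (reduction of polynomial
  identities), whose line is a STRONG line (`exists_isStrongLinePoint_of_fatFlag`) cut out by the
  reduced chart forms (`StrongLineCover.mem_ideal_span_chartForm_of_forall_eval_eq_zero`).

Result: `GenericStrongLine.exists_strongLine_of_vertical` — **every point of `S` over a closed point
of `Z` projects into (the closure of) a strong line of `V₊(Q, C)`**.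

## References

* A. Hirschowitz, J. N. N. Iyer, Contemp. Math. 522 (2010), arXiv:0903.5018, §2 Lemma 2.2 (proof).
  [HirschowitzIyer2010]
* W. Fulton, *Intersection Theory* (1998), §10.1. [Fulton1998]
* Z. Tian, H. R. Zong, Compositio Math. 150 (2014), proof of Prop. 7.2 (the method). [TianZong2014]
-/

noncomputable section

open CategoryTheory CategoryTheory.Limits AlgebraicGeometry Order MonoidalCategory IsLocalRing MvPolynomial
  TopologicalSpace
open Literature.AlgebraicGeometry.Motives.Segre

universe u

namespace Literature.AlgebraicGeometry.Motives

attribute [local instance] MvPolynomial.gradedAlgebra MvPolynomial.algebraMvPolynomial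
  Literature.AlgebraicGeometry.Motives.ProjBaseChange.algebraBase UniversalHyperplaneSection.sectionsAlgebra

/-! ### Tensors under an injective map of fields -/

namespace StrongLineCover

variable {K L : Type*} [Field K] [Field L] (φ : K →+* L)

/-- `tensor2` commutes with an injective change of coefficients. [folklore] -/
theorem tensor2_map (Q : MvPolynomial (Fin 9) K) (i j : Fin 9) :
    tensor2 (MvPolynomial.map φ Q) i j = φ (tensor2 Q i j) := by
  classical
  simp only [tensor2, support_map_of_injective Q φ.injective, coeff_map, map_sum]
  refine Finset.sum_congr rfl fun m _ => ?_
  split_ifs <;> simp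

/-- `tensor3` commutes with an injective change of coefficients. [folklore] -/
theorem tensor3_map (C : MvPolynomial (Fin 9) K) (p : Fin 9 × Fin 9 × Fin 9) :
    tensor3 (MvPolynomial.map φ C) p = φ (tensor3 C p) := by
  classical
  simp only [tensor3, support_map_of_injective C φ.injective, coeff_map, map_sum]
  refine Finset.sum_congr rfl fun m _ => ?_
  split_ifs <;> simp

/-- A fat flag FOR FORMS (`Q ≡ 0` on the plane, `C(c₀u + c₁v + c₂w) = c₂³ C(w)`) is a fat flag for
their tensors. [folklore] -/
theorem isFatFlag_of_forms {R : Type*} [Field R] {Q C : MvPolynomial (Fin 9) R} (hQ : Q.IsHomogeneous 2)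
    (hC : C.IsHomogeneous 3) {u v w : Fin 9 → R}
    (hQvan : ∀ c : Fin 3 → R, MvPolynomial.eval (comb u v w c) Q = 0)
    (hCfat : ∀ c : Fin 3 → R, MvPolynomial.eval (comb u v w c) C = c 2 ^ 3 * MvPolynomial.eval w C) :
    IsFatFlag (tensor2 Q) (tensor3 C) u v w :=
  ⟨fun c => by rw [bilin_tensor2 hQ, hQvan c], fun c => by rw [trilin_tensor3 hC, trilin_tensor3 hC, hCfat c]⟩

/-- Conversely, a fat flag for the tensors is a fat flag for the forms. [folklore] -/
theorem forms_of_isFatFlag {R : Type*} [Field R] {Q C : MvPolynomial (Fin 9) R} (hQ : Q.IsHomogeneous 2)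
    (hC : C.IsHomogeneous 3) {u v w : Fin 9 → R} (h : IsFatFlag (tensor2 Q) (tensor3 C) u v w) :
    (∀ c : Fin 3 → R, MvPolynomial.eval (comb u v w c) Q = 0) ∧
      ∀ c : Fin 3 → R, MvPolynomial.eval (comb u v w c) C = c 2 ^ 3 * MvPolynomial.eval w C :=
  ⟨fun c => by rw [← bilin_tensor2 hQ]; exact h.1 c,
    fun c => by rw [← trilin_tensor3 hC, ← trilin_tensor3 hC]; exact h.2 c⟩

end StrongLineCover

namespace GenericStrongLine

open ProjBaseChangeRing StrongLineCover ProjFamily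

variable {K : Type u} [Field K] {Q C : MvPolynomial (Fin (8 + 1)) K}
  {w : ↥(quadricCubic Q C).left} (𝔏 : GenericStrongLine Q C w)

/-! ### The generic strong line as a fat flag over `K(Z)` -/

/-- The triple `(u, v, y)` is independent over `K(Z)`. [folklore] -/
theorem linearIndependent_uz_vz_yz : LinearIndependent 𝔏.Kz ![𝔏.uz, 𝔏.vz, 𝔏.yz] := by
  have h3 : LinearIndependent 𝔏.Kz (fun i => (𝔏.e : (𝔏.F' : Type u) ≃+* 𝔏.Kz) ∘ (![𝔏.u, 𝔏.v, 𝔏.y] i)) :=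
    ProjFamily.linearIndependent_comp_ringEquiv (𝔏.e : (𝔏.F' : Type u) ≃+* 𝔏.Kz) 𝔏.hli
  have heq : (fun i => (𝔏.e : (𝔏.F' : Type u) ≃+* 𝔏.Kz) ∘ (![𝔏.u, 𝔏.v, 𝔏.y] i)) = ![𝔏.uz, 𝔏.vz, 𝔏.yz] := by
    funext i; fin_cases i <;> rfl
  rwa [heq] at h3

/-- **The generic strong line is a `3`-fat flag over `K(Z)`** for the tensors of `Q` and `C`.
[cite: HirschowitzIyer2010, §2 Prop. 2.3] -/
theorem isFatFlag_Kz (hQ : Q.IsHomogeneous 2) (hC : C.IsHomogeneous 3) :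
    IsFatFlag (fun i j => algebraMap K 𝔏.Kz (tensor2 Q i j)) (fun p => algebraMap K 𝔏.Kz (tensor3 C p))
      𝔏.uz 𝔏.vz 𝔏.yz := by
  set ψ : K →+* (𝔏.F' : Type u) := (algebraMap (curveField w) 𝔏.F').comp (algebraMap K (curveField w)) with hψ
  have hF : IsFatFlag (tensor2 (MvPolynomial.map ψ Q)) (tensor3 (MvPolynomial.map ψ C)) 𝔏.u 𝔏.v 𝔏.y :=
    isFatFlag_of_forms (hQ.map ψ) (hC.map ψ) 𝔏.hQ 𝔏.hC
  have hF' : IsFatFlag (fun i j => ψ (tensor2 Q i j)) (fun p => ψ (tensor3 C p)) 𝔏.u 𝔏.v 𝔏.y := by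
    have e2 : (tensor2 (MvPolynomial.map ψ Q)) = fun i j => ψ (tensor2 Q i j) := by
      funext i j; exact tensor2_map ψ Q i j
    have e3 : (tensor3 (MvPolynomial.map ψ C)) = fun p => ψ (tensor3 C p) := by
      funext p; exact tensor3_map ψ C p
    rw [e2, e3] at hF; exact hF
  have h := hF'.map (𝔏.e : (𝔏.F' : Type u) →+* 𝔏.Kz) 𝔏.e.surjective
  have hcomp : ∀ c : K, (𝔏.e : (𝔏.F' : Type u) →+* 𝔏.Kz) (ψ c) = algebraMap K 𝔏.Kz c := fun c => by
    rw [𝔏.algebraMap_Kz]; rfl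
  simp only [hcomp] at h
  exact h

/-! ### Closed points of the parameter curve -/

/-- A point of `Z` other than the generic point is closed (`dim Z = 1`). [folklore] -/
theorem isClosed_of_ne_genericPoint (hw : height w = 1) {z : ↥(𝔏.Z).left}
    (hz : z ≠ genericPoint (𝔏.Z).left) : IsClosed ({z} : Set ↥(𝔏.Z).left) := by
  have hη : height (genericPoint (𝔏.Z).left) = 1 := by
    rw [height_genericPoint_paramCurve, hw]
  have hle : height z ≤ 1 := by
    rw [← hη]
    exact height_mono (Scheme.le_iff_specializes.mpr ((genericPoint_spec (𝔏.Z).left).specializes (Set.mem_univ z)))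
  have h0 : height z = 0 := by
    rcases eq_or_lt_of_le hle with h | h
    · exact absurd (eq_genericPoint_of_height_eq_one hη h) hz
    · exact Order.lt_one_iff.mp h
  exact isClosed_singleton_of_height_eq_zero h0

/-! ### Limits of strong lines are strong lines -/

section Vertical

variable [IsAlgClosed K]

set_option maxHeartbeats 800000 in
/-- **The vertical fibres of `S` project into strong lines** (Hirschowitz–Iyer, proof of Lemma 2.2:
`pr_{2*}(ψ⁻¹(D)) ∈ QCH^{(1)}_1(Y)`): for every point `s` of the ruled surface `S` lying over a point
`z ≠ η_Z` of the parameter curve there is a STRONG LINE POINT `ℓ` of `V₊(Q, C)` with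
`π(s) ∈ closure {ℓ}` (in `V₊(Q) ⊆ ℙ⁸`). [cite: HirschowitzIyer2010, §2 Lemma 2.2 (proof)]
[cite: Fulton1998, §10.1] [cite: TianZong2014, proof of Prop. 7.2] -/
theorem exists_strongLine_of_vertical (hQ : Q.IsHomogeneous 2) (hC : C.IsHomogeneous 3)
    (hw : height w = 1) {s : (𝔏.S).carrier}
    (hs : (CartesianMonoidalCategory.snd (projectiveSpace 8 K) 𝔏.Z).left ((𝔏.S).ι s) ≠ genericPoint (𝔏.Z).left) :
    ∃ ℓ : ↥(quadricCubic Q C).left, IsStrongLinePoint Q C 1 ℓ ∧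
      quadricι Q ((𝔏.πq).left s) ∈ closure {quadricι Q ((quadricCubicToQuadric Q C).left ℓ)} := by
  classical
  let B : SchemeOver K := 𝔏.Z
  set z : ↥B.left := (CartesianMonoidalCategory.snd (projectiveSpace 8 K) 𝔏.Z).left ((𝔏.S).ι s) with hz
  have hzcl : IsClosed ({z} : Set ↥B.left) := 𝔏.isClosed_of_ne_genericPoint hw hs
  -- an affine neighbourhood `U = Spec A` of `z`
  obtain ⟨_, ⟨U, hU, rfl⟩, hzU, -⟩ :=
    B.left.isBasis_affineOpens.exists_subset_of_mem_open (Set.mem_univ z) isOpen_univ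
  haveI : Nonempty U := ⟨⟨z, hzU⟩⟩
  haveI hST : IsScalarTower K Γ(B.left, U) 𝔏.Kz := isScalarTower_sections_functionField B U
  obtain ⟨x, hx⟩ : ∃ x : U, (x : B.left) = z := ⟨⟨z, hzU⟩, rfl⟩
  -- the local ring at `z`: a DVR with fraction field `K(Z)`, a localization of `A`
  haveI hloc : IsLocalization.AtPrime (B.left.presheaf.stalk (x : B.left)) (hU.primeIdealOf x).asIdeal :=
    hU.isLocalization_stalk x
  haveI : IsScalarTower Γ(B.left, U) (B.left.presheaf.stalk (x : B.left)) B.left.functionField :=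
    functionField_isScalarTower B.left U x
  haveI hdvr : IsDiscreteValuationRing (B.left.presheaf.stalk (x : B.left)) := by
    rw [hx]; exact isDiscreteValuationRing_stalk_paramCurve w (𝔏.F' : Type u) hw hs
  haveI : ValuationRing (B.left.presheaf.stalk (x : B.left)) := inferInstance
  set 𝒪 : ValuationSubring 𝔏.Kz := CurvePlaces.valuationSubringOfPoint (x : B.left) with h𝒪
  -- evaluation at `z`, the `A`-algebra structure on `K`, its kernel
  have hzU' : (x : B.left) ∈ U := x.2
  have hzcl' : IsClosed ({(x : B.left)} : Set ↥B.left) := by rw [hx]; exact hzcl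
  letI algk : Algebra Γ(B.left, U) K := (ev B hzcl' hzU').toAlgebra
  have hret : ∀ c : K, algebraMap Γ(B.left, U) K (algebraMap K Γ(B.left, U) c) = c :=
    ev_scalarRingHom B hzcl' hzU'
  have hsurj : Function.Surjective (algebraMap Γ(B.left, U) K) := ev_surjective B hzcl' hzU'
  have hrange : Set.range (pt B hU).base = {(x : B.left)} := range_pt_eq B hU hzcl' hzU'
  have hker : RingHom.ker (algebraMap Γ(B.left, U) K) = (hU.primeIdealOf x).asIdeal := by
    have h := ker_ev_eq_primeIdealOf B hU hzcl' hzU'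
    rwa [show (⟨(x : B.left), hzU'⟩ : U) = x from Subtype.ext rfl] at h
  -- Step 1: the generic strong line, pivoted into `𝒪⁹`
  obtain ⟨i₀, j₀, c₀, u', v', w', hu', hv', hw', hui, huj, hvi, hvj, hwi, hwj, hwc, ⟨α, β, γ', δ, hu'eq, hv'eq⟩,
    hxuv, hauv, -, hfat'⟩ :=
    exists_integral_fatFlag_of_linearIndependent (𝒪 := 𝒪) 𝔏.linearIndependent_uz_vz_yz (𝔏.isFatFlag_Kz hQ hC)
  have hij : i₀ ≠ j₀ := i₀_ne_j₀ hui huj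
  -- germs of the coordinates
  have hgerm : ∀ t : 𝔏.Kz, t ∈ 𝒪 → ∃ g : B.left.presheaf.stalk (x : B.left), RatFn.toFunctionField (x : B.left) g = t :=
    fun t ht => ht
  choose gu hgu using fun i => hgerm (u' i) (hu' i)
  choose gv hgv using fun i => hgerm (v' i) (hv' i)
  choose gw hgw using fun i => hgerm (w' i) (hw' i)
  -- Step 2: clear denominators: a common `t ∉ 𝔭_z` with `t • gu i`, `t • gv i` sections over `U`
  obtain ⟨t, ht⟩ := IsLocalization.exist_integer_multiples (hU.primeIdealOf x).asIdeal.primeCompl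
    (Finset.univ : Finset (Bool × Fin (8 + 1))) (fun q => if q.1 then gu q.2 else gv q.2)
  choose! yy hyy using ht
  have hyu : ∀ i, algebraMap Γ(B.left, U) (B.left.presheaf.stalk (x : B.left)) (yy (true, i)) =
      algebraMap Γ(B.left, U) (B.left.presheaf.stalk (x : B.left)) t * gu i := fun i => by
    rw [hyy (true, i) (Finset.mem_univ _), Algebra.smul_def]
    simp
  have hyv : ∀ i, algebraMap Γ(B.left, U) (B.left.presheaf.stalk (x : B.left)) (yy (false, i)) =
      algebraMap Γ(B.left, U) (B.left.presheaf.stalk (x : B.left)) t * gv i := fun i => by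
    rw [hyy (false, i) (Finset.mem_univ _), Algebra.smul_def]
    simp
  -- the forms over `A`
  let μA : Fin (8 + 1) → MvPolynomial (Fin (8 + 1)) Γ(B.left, U) := fun c =>
    MvPolynomial.C (t : Γ(B.left, U)) * X c - MvPolynomial.C (yy (true, c)) * X i₀ - MvPolynomial.C (yy (false, c)) * X j₀
  -- Step 3: they vanish at `γ` after scalar extension to `K(Z)`
  have hKzeq : ∀ a : Γ(B.left, U), algebraMap Γ(B.left, U) 𝔏.Kz a =
      RatFn.toFunctionField (x : B.left) (algebraMap Γ(B.left, U) (B.left.presheaf.stalk (x : B.left)) a) :=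
    fun a => IsScalarTower.algebraMap_apply _ _ _ a
  have hμAK : ∀ c, c ≠ i₀ → c ≠ j₀ → MvPolynomial.map (algebraMap Γ(B.left, U) 𝔏.Kz) (μA c) ∈
      ProjectiveSpectrum.asHomogeneousIdeal (𝒜 := MvPolynomial.homogeneousSubmodule (Fin (8 + 1)) 𝔏.Kz) 𝔏.lineData.γ := by
    intro c hci hcj
    have hmap : MvPolynomial.map (algebraMap Γ(B.left, U) 𝔏.Kz) (μA c) =
        MvPolynomial.C (algebraMap Γ(B.left, U) 𝔏.Kz t) * chartForm u' v' i₀ j₀ c := by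
      simp only [μA, map_sub, map_mul, map_C, map_X, chartForm, hKzeq, hyu, hyv, map_mul, hgu, hgv]
      ring
    rw [hmap]
    refine Ideal.mul_mem_left _ _ (𝔏.lineData.mem_γ_of_forall_eval_eq_zero fun q hq => ?_)
    -- `q ∈ span(uz, vz) ⊆ span(u', v')`
    refine eval_chartForm_of_mem_span hui huj hvi hvj c ?_
    have huz : 𝔏.uz ∈ Submodule.span 𝔏.Kz (Set.range ![u', v']) := by
      rw [Matrix.range_cons_cons_empty, Submodule.mem_span_pair]
      exact ⟨𝔏.uz i₀, 𝔏.uz j₀, by funext i; simp [hxuv i]⟩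
    have hvz : 𝔏.vz ∈ Submodule.span 𝔏.Kz (Set.range ![u', v']) := by
      rw [Matrix.range_cons_cons_empty, Submodule.mem_span_pair]
      exact ⟨𝔏.vz i₀, 𝔏.vz j₀, by funext i; simp [hauv i]⟩
    have hle : Submodule.span 𝔏.Kz (Set.range ![𝔏.uz, 𝔏.vz]) ≤ Submodule.span 𝔏.Kz (Set.range ![u', v']) := by
      rw [Submodule.span_le, Matrix.range_cons_cons_empty]
      rintro _ (rfl | rfl)
      · exact huz
      · exact hvz
    exact hle hq
  -- Step 4: specialise to the fibre over `z`
  have hw' : (𝔏.S).ι s ∈ closure {(openPiece 8 B hU) ((Proj.map (mapGraded Γ(B.left, U) 𝔏.Kz (Fin (8 + 1)))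
      (irrelevant_le_map Γ(B.left, U) 𝔏.Kz (Fin (8 + 1)))) 𝔏.lineData.γ)} := by
    have hι := eq_map_comp_openPiece 8 B hU (genFibι w (𝔏.F' : Type u)) (genFibι_fst w (𝔏.F' : Type u))
      ((genFibι_snd w (𝔏.F' : Type u)).trans (by rw [fromSpecStalk_genericPoint_eq B hU]))
    have h1 : (𝔏.S).ι s ∈ closure ((genFibι w (𝔏.F' : Type u)) '' Set.range 𝔏.lineData.lineSub.ι) := by
      rw [← range_surf_ι]; exact ⟨s, rfl⟩
    have h2 : (genFibι w (𝔏.F' : Type u)) '' Set.range 𝔏.lineData.lineSub.ι ⊆ closure {genFibι w (𝔏.F' : Type u) 𝔏.lineData.γ} := by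
      rw [𝔏.lineData.range_lineSub_ι, ← 𝔏.lineData.closure_γ]
      refine (image_closure_subset_closure_image (genFibι w (𝔏.F' : Type u)).continuous).trans ?_
      rw [Set.image_singleton]
    have h3 := (closure_mono h2) h1
    rw [closure_closure] at h3
    have h4 : genFibι w (𝔏.F' : Type u) 𝔏.lineData.γ = (openPiece 8 B hU) ((Proj.map (mapGraded Γ(B.left, U) 𝔏.Kz (Fin (8 + 1)))
        (irrelevant_le_map Γ(B.left, U) 𝔏.Kz (Fin (8 + 1)))) 𝔏.lineData.γ) := by
      rw [hι]; rfl
    rw [h4] at h3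
    exact h3
  have hbmem : (CartesianMonoidalCategory.snd (projectiveSpace 8 K) B).left ((𝔏.S).ι s) ∈ Set.range (pt B hU).base := by
    rw [hrange]
    change z ∈ ({(x : B.left)} : Set ↥B.left)
    rw [hx]
    exact Set.mem_singleton z
  have hvan : ∀ c, c ≠ i₀ → c ≠ j₀ → MvPolynomial.map (algebraMap Γ(B.left, U) K) (μA c) ∈
      ProjectiveSpectrum.asHomogeneousIdeal (𝒜 := MvPolynomial.homogeneousSubmodule (Fin (8 + 1)) K) (𝔏.prS s) :=
    fun c hci hcj => map_mem_asHomogeneousIdeal_of_mem_closure 8 B hU hret 𝔏.lineData.γ hbmem hw' (hμAK c hci hcj)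
  -- Step 5: the residue isomorphism `κ(𝒪) ≃ K` and the reduced flag
  have h𝔭max : (hU.primeIdealOf x).asIdeal.IsMaximal := hker ▸ RingHom.ker_isMaximal_of_surjective _ hsurj
  let ψ₀ : Γ(B.left, U) ⧸ (hU.primeIdealOf x).asIdeal ≃+* K :=
    (Ideal.quotEquivOfEq hker.symm).trans (RingHom.quotientKerEquivOfSurjective hsurj)
  have hψ : ∀ a : Γ(B.left, U), ψ₀ (Ideal.Quotient.mk _ a) = algebraMap Γ(B.left, U) K a := by
    intro a
    change RingHom.quotientKerEquivOfSurjective hsurj (Ideal.quotEquivOfEq hker.symm (Ideal.Quotient.mk _ a)) = _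
    rw [Ideal.quotEquivOfEq_mk]
    exact RingHom.quotientKerEquivOfSurjective_apply_mk hsurj a
  let θ : Γ(B.left, U) ⧸ (hU.primeIdealOf x).asIdeal ≃+* ResidueField (B.left.presheaf.stalk (x : B.left)) :=
    IsLocalization.AtPrime.equivQuotMaximalIdeal (hU.primeIdealOf x).asIdeal (B.left.presheaf.stalk (x : B.left))
  have hθ : ∀ a : Γ(B.left, U), θ (Ideal.Quotient.mk _ a) =
      residue _ (algebraMap Γ(B.left, U) (B.left.presheaf.stalk (x : B.left)) a) := fun a => rfl
  let σ : ResidueField (B.left.presheaf.stalk (x : B.left)) ≃+* K := θ.symm.trans ψ₀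
  have hσ : ∀ a : Γ(B.left, U), σ (residue _ (algebraMap Γ(B.left, U) (B.left.presheaf.stalk (x : B.left)) a)) =
      algebraMap Γ(B.left, U) K a := by
    intro a
    change ψ₀ (θ.symm (residue _ _)) = _
    rw [← hθ, RingEquiv.symm_apply_apply, hψ]
  -- constants: `σ (residue (c)) = c`
  have hconst : ∀ c : K, σ (residue _ (algebraMap K (B.left.presheaf.stalk (x : B.left)) c)) = c := by
    intro c
    have h1 : algebraMap K (B.left.presheaf.stalk (x : B.left)) c =
        algebraMap Γ(B.left, U) (B.left.presheaf.stalk (x : B.left)) (algebraMap K Γ(B.left, U) c) := by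
      have hinj := RatFn.toFunctionField_injective (X := B.left) (x : B.left)
      apply hinj
      rw [← hKzeq, ← IsScalarTower.algebraMap_apply K Γ(B.left, U) 𝔏.Kz]
      exact (IsScalarTower.algebraMap_apply K (B.left.presheaf.stalk (x : B.left)) 𝔏.Kz c).symm
    rw [h1, hσ]
    exact hret c
  -- the reduced vectors
  set ub : Fin (8 + 1) → K := fun i => σ (residue _ (gu i)) with hub
  set vb : Fin (8 + 1) → K := fun i => σ (residue _ (gv i)) with hvb
  set wb : Fin (8 + 1) → K := fun i => σ (residue _ (gw i)) with hwb
  have hinjO := RatFn.toFunctionField_injective (X := B.left) (x : B.left)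
  have hred1 : ∀ {g : B.left.presheaf.stalk (x : B.left)}, RatFn.toFunctionField (x : B.left) g = 1 → σ (residue _ g) = 1 := by
    intro g hg
    have : g = 1 := hinjO (by rw [hg, map_one])
    rw [this, map_one, map_one]
  have hred0 : ∀ {g : B.left.presheaf.stalk (x : B.left)}, RatFn.toFunctionField (x : B.left) g = 0 → σ (residue _ g) = 0 := by
    intro g hg
    have : g = 0 := hinjO (by rw [hg, map_zero])
    rw [this, map_zero, map_zero]
  have hubi : ub i₀ = 1 := hred1 ((hgu i₀).trans hui)
  have hubj : ub j₀ = 0 := hred0 ((hgu j₀).trans huj)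
  have hvbi : vb i₀ = 0 := hred0 ((hgv i₀).trans hvi)
  have hvbj : vb j₀ = 1 := hred1 ((hgv j₀).trans hvj)
  have hwbi : wb i₀ = 0 := hred0 ((hgw i₀).trans hwi)
  have hwbj : wb j₀ = 0 := hred0 ((hgw j₀).trans hwj)
  have hwbc : wb c₀ = 1 := hred1 ((hgw c₀).trans hwc)
  have hlib : LinearIndependent K ![ub, vb, wb] := linearIndependent_of_chartNormalForm hubi hubj hvbi hvbj hwbi hwbj hwbc
  -- the reduced flag is fat for `(Q, C)`
  have hfatO : IsFatFlag (fun i j => algebraMap K (B.left.presheaf.stalk (x : B.left)) (tensor2 Q i j))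
      (fun p => algebraMap K (B.left.presheaf.stalk (x : B.left)) (tensor3 C p)) gu gv gw := by
    refine IsFatFlag.of_injective (RatFn.toFunctionField (x : B.left)) hinjO ?_
    have eB : (fun i j => RatFn.toFunctionField (x : B.left) (algebraMap K (B.left.presheaf.stalk (x : B.left)) (tensor2 Q i j))) =
        fun i j => algebraMap K 𝔏.Kz (tensor2 Q i j) := by
      funext i j; exact (IsScalarTower.algebraMap_apply K (B.left.presheaf.stalk (x : B.left)) 𝔏.Kz _).symm
    have eT : (fun p => RatFn.toFunctionField (x : B.left) (algebraMap K (B.left.presheaf.stalk (x : B.left)) (tensor3 C p))) =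
        fun p => algebraMap K 𝔏.Kz (tensor3 C p) := by
      funext p; exact (IsScalarTower.algebraMap_apply K (B.left.presheaf.stalk (x : B.left)) 𝔏.Kz _).symm
    have eu : (RatFn.toFunctionField (x : B.left)) ∘ gu = u' := funext hgu
    have ev' : (RatFn.toFunctionField (x : B.left)) ∘ gv = v' := funext hgv
    have ew : (RatFn.toFunctionField (x : B.left)) ∘ gw = w' := funext hgw
    rw [eB, eT, eu, ev', ew]
    exact hfat'
  have hfatK : IsFatFlag (tensor2 Q) (tensor3 C) ub vb wb := by
    have h := (hfatO.map (residue (B.left.presheaf.stalk (x : B.left))) residue_surjective).map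
      (σ : ResidueField (B.left.presheaf.stalk (x : B.left)) →+* K) σ.surjective
    have eB : (fun i j => (σ : _ →+* K) (residue _ (algebraMap K (B.left.presheaf.stalk (x : B.left)) (tensor2 Q i j)))) = tensor2 Q := by
      funext i j; exact hconst _
    have eT : (fun p => (σ : _ →+* K) (residue _ (algebraMap K (B.left.presheaf.stalk (x : B.left)) (tensor3 C p)))) = tensor3 C := by
      funext p; exact hconst _
    rw [eB, eT] at h
    exact h
  obtain ⟨hQvan, hCfat⟩ := forms_of_isFatFlag hQ hC hfatK
  -- Step 6: the reduced chart forms vanish at `pr₁ s`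
  have htk : algebraMap Γ(B.left, U) K t ≠ 0 := by
    intro h0
    have ht𝔭 : (t : Γ(B.left, U)) ∈ RingHom.ker (algebraMap Γ(B.left, U) K) := h0
    rw [hker] at ht𝔭
    exact t.2 ht𝔭
  have hredu : ∀ i, algebraMap Γ(B.left, U) K (yy (true, i)) = algebraMap Γ(B.left, U) K t * ub i := by
    intro i
    rw [← hσ, ← hσ, hyu, map_mul, map_mul]
  have hredv : ∀ i, algebraMap Γ(B.left, U) K (yy (false, i)) = algebraMap Γ(B.left, U) K t * vb i := by
    intro i
    rw [← hσ, ← hσ, hyv, map_mul, map_mul]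
  have hchart : ∀ c, c ≠ i₀ → c ≠ j₀ → chartForm ub vb i₀ j₀ c ∈
      ProjectiveSpectrum.asHomogeneousIdeal (𝒜 := MvPolynomial.homogeneousSubmodule (Fin (8 + 1)) K) (𝔏.prS s) := by
    intro c hci hcj
    have hmap : MvPolynomial.map (algebraMap Γ(B.left, U) K) (μA c) =
        MvPolynomial.C (algebraMap Γ(B.left, U) K t) * chartForm ub vb i₀ j₀ c := by
      simp only [μA, map_sub, map_mul, map_C, map_X, chartForm, hredu, hredv, map_mul]
      ring
    have h := hvan c hci hcj
    rw [hmap] at h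
    have hu : IsUnit (MvPolynomial.C (algebraMap Γ(B.left, U) K t) : MvPolynomial (Fin (8 + 1)) K) :=
      (isUnit_iff_ne_zero.mpr htk).map MvPolynomial.C
    exact (Ideal.unit_mul_mem_iff_mem _ hu).mp h
  -- Step 7: the seven reduced chart forms as a family `Fin 7 → …`
  have hcardT : Fintype.card {c : Fin (8 + 1) // c ≠ i₀ ∧ c ≠ j₀} = 8 - 1 := by
    rw [Fintype.card_subtype]
    have : (Finset.univ.filter fun c : Fin (8 + 1) => c ≠ i₀ ∧ c ≠ j₀) = Finset.univ \ {i₀, j₀} := by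
      ext c; simp [not_or]
    rw [this, Finset.card_sdiff_of_subset (Finset.subset_univ _), Finset.card_pair hij, Finset.card_univ, Fintype.card_fin]
  obtain ⟨eT⟩ : Nonempty (Fin (8 - 1) ≃ {c : Fin (8 + 1) // c ≠ i₀ ∧ c ≠ j₀}) :=
    ⟨(Fintype.equivFinOfCardEq hcardT).symm⟩
  set Lf : Fin (8 - 1) → MvPolynomial (Fin (8 + 1)) K := fun j => chartForm ub vb i₀ j₀ (eT j) with hLf
  have hLfrange : Set.range Lf = (fun c => chartForm ub vb i₀ j₀ c) '' {c | c ≠ i₀ ∧ c ≠ j₀} := by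
    ext G
    constructor
    · rintro ⟨j, rfl⟩; exact ⟨eT j, (eT j).2, rfl⟩
    · rintro ⟨c, hc, rfl⟩
      refine ⟨eT.symm ⟨c, hc⟩, ?_⟩
      simp only [hLf, Equiv.apply_symm_apply]
  have hLhom : ∀ j, (Lf j).IsHomogeneous 1 := fun j => isHomogeneous_chartForm _ _ _ _ _
  have hLuniv : ∀ G : MvPolynomial (Fin (8 + 1)) K,
      (∀ q ∈ Submodule.span K (Set.range ![ub, vb]), MvPolynomial.eval q G = 0) → G ∈ Ideal.span (Set.range Lf) := by
    intro G hG
    rw [hLfrange]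
    exact mem_ideal_span_chartForm_of_forall_eval_eq_zero hubi hubj hvbi hvbj G hG
  have hLli : LinearIndependent K Lf := by
    have hall := Literature.RingTheory.MvPolynomial.linearIndependent_coordForm (chartBasis hubi hubj hvbi hvbj)
    have hcomp := hall.comp (fun j => ((eT j : {c : Fin (8 + 1) // c ≠ i₀ ∧ c ≠ j₀}) : Fin (8 + 1)))
      (fun a b hab => eT.injective (Subtype.ext hab))
    have heq : Lf = (fun i : Fin (8 + 1) => (∑ m : Fin (8 + 1), MvPolynomial.C ((chartBasis hubi hubj hvbi hvbj).repr (Pi.single m 1) i) * X m :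
        MvPolynomial (Fin (8 + 1)) K)) ∘ (fun j => ((eT j : {c : Fin (8 + 1) // c ≠ i₀ ∧ c ≠ j₀}) : Fin (8 + 1))) := by
      funext j
      exact (coordForm_chartBasis hubi hubj hvbi hvbj (eT j).2).symm
    rw [heq]
    exact hcomp
  -- Step 8: the strong line
  obtain ⟨ℓ, hℓ, hcl⟩ := exists_isStrongLinePoint_of_fatFlag hlib hQvan hCfat Lf hLli hLhom hLuniv
  refine ⟨ℓ, hℓ, ?_⟩
  rw [hcl, quadricι_πq]
  refine (ProjectiveSpectrum.mem_zeroLocus _ _ _).mpr ?_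
  rintro _ ⟨j, rfl⟩
  exact hchart _ (eT j).2.1 (eT j).2.2

end Vertical

end GenericStrongLine

end Literature.AlgebraicGeometry.Motives

end
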